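import Summits.NavierStokesRegularity.NavierStokesRegularity.Theorems.ScenarioCensusRowF1ScrewTop
import HarnessLib

/-!
# LINE 41 «screw-top» port, part 2/3: §4b limits with a MOVING APEX, the two defects and the two LEVELS (`helical_limit` / `crystal_limit`, `exists_helicalLevel` / `exists_crystalLevel`;
# LINE 40's `tendsto_eval` BY NAME); §5 THE FLOORS, proved (`helicalFloor_holds`, `crystalFloor_holds`; LINE 40's `le_of_units` / `row_of_floor` BY NAME), the census ROWS as corollaries
# (`rowF1hx_holds`, `rowF1cx_holds`), the threshold `helicalLevel` and the floor read pointwise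

Re-homed for the scenario census (typer seat ns-census-typer-1 g10; the cells F1hx / F1cx and the floors HXF / CXF are MEMBERS OF RECORD «DECIDED IN KERNEL IN FILES» of row F1
(item 87: critic idea-crit-3 g10 PASS no price tier B 12:52:23Z; ref PRE-CHECK ✓ §19.21; lead label LR2016 §10.4 / Pineau–Vicol 2607.09619); this port makes them TREE-decided):
VERBATIM PORT of ns-idea-3 LINE 41 «screw-top», `pub/ideators/ns-idea-3/lines/screw-top/line-screw-top.lean` sha16 61b2c9f392c9fdfd (1140 l., lean check rc 0, 0 sorry), split for
the 400-line rule into `ScenarioCensusRowF1ScrewTop` (§1–§4a) → `…ScrewTopLevels` (§4b–§5) → `…ScrewTopRows` (§6–§7 + census KEYS).  Lean text VERBATIM in namespace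
`…Theorems.ScenarioCensus.ScrewTop` (the line's `…Cruxes.ScenarioCensusRowF1.ScrewTopLine` re-homed); port edits: the frame restated VERBATIM by the line from LINES 34–40 (`topSet`,
`HasTypeIConstant`, `snapLevel`, `exists_fast_at`, `sqrt_mul_sq_mul`, `limitClass_compact`, `exists_level_of_limitKill`, `exists_witnessZoom_package`, `zoom_units`,
`eventually_forall_not_of_not_frequently`, `continuous_slice'`, `tendsto_eval`, `le_of_units`, `row_of_floor`) is taken BY NAME from the landed two-time-top /
one-level-top / snapshot-top / needle-top / echo-top / scaling-top ports; the elementary `rotZ` / class lemmas the line restates are the tree's BY NAME (`rotZ_add_vec'` =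
`ScrewBlowdown.rotZ_add_vec`, `rotZ_add_smul_eZ'` = `ScrewBlowdown.rotZ_add_smul_eZ` (census screw-blowdown port), `rotZ_smul_vec'` = `rotZ_smul`, `rotZ_neg_rotZ'` = `rotZ_neg_apply_rotZ`,
`continuous_rotZ`, `centre_mem` = `IsTypeIAncientMild.comp_add_right` (Literature.Analysis.FluidPDE)); `analyticAt_linIso` and `tendstoLocallyUniformly_comp_of_tendsto` (twins of lemmas in
route-cone modules that are not imported) are not re-declared — the former's one-line proof term is inlined at its use sites; `@[conjecture]` on the residual `HelicalCollapse` (≡ `ScenarioCensus.Row_F1`, OPEN); one-line docstrings added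
where missing (gate lint).  Statements untouched.

No census VALUE is moved here (row F1 stays OPEN-WITH-LINE; the members become TREE-decided by name); NS regularity is NOT proved; `Row_F1` is untouched (zero
movement, `helicalCollapse_iff_rowF1`); no summit statement is proved by this file. Lemmas that restate already-landed tree declarations are taken BY NAME (gate lint `dedup.landed`): `topSet` = `TwoTimeTop.topSet`, `HasTypeIConstant` = `OneLevelTop.HasTypeIConstant`, `snapLevel` = `SnapshotTop.snapLevel`, `exists_fast_at` = `SnapshotTop.exists_fast_at`, `sqrt_mul_sq_mul` = `SnapshotTop.sqrt_mul_sq_mul`, `limitClass_compact` = `NeedleTop.limitClass_compact`, `exists_level_of_limitKill` = `NeedleTop.exists_level_of_limitKill`, `zoom_units` = `NeedleTop.zoom_units`, `exists_witnessZoom_package` = `EchoTop.exists_witnessZoom_package`, `eventually_forall_not_of_not_frequently` = `EchoTop.eventually_forall_not_of_not_frequently`, `continuous_slice'` = `ScalingTop.continuous_slice'`, `tendsto_eval` = `ScalingTop.tendsto_eval`, `le_of_units` = `ScalingTop.le_of_units`, `row_of_floor` = `ScalingTop.row_of_floor`, `centre_mem` = `IsTypeIAncientMild.comp_add_right`, `rotZ_add_vec'`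 = `ScrewBlowdown.rotZ_add_vec`, `rotZ_smul_vec'` = `rotZ_smul`, `rotZ_add_smul_eZ'` = `ScrewBlowdown.rotZ_add_smul_eZ`, `rotZ_neg_rotZ'` = `rotZ_neg_apply_rotZ`.
-/

-- the summit and its single problem share the name `NavierStokesRegularity` (D-0017 nested layout)
set_option linter.dupNamespace false

noncomputable section

open MeasureTheory Set Function Filter TopologicalSpace Metric
open scoped Topology NNReal ENNReal InnerProductSpace

namespace Summit.NavierStokesRegularity.NavierStokesRegularity.Theorems.ScenarioCensus.ScrewTop

open Literature.Analysis Literature.Analysis.FluidPDE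
open Summit.NavierStokesRegularity.NavierStokesRegularity.Theorems
open Summit.NavierStokesRegularity.NavierStokesRegularity.Theses
open Summit.NavierStokesRegularity.NavierStokesRegularity.Theorems.LocalHelicityTubeDoorFrobeniusProfileRigidityHelicalSlice

/-! ### Limits with a MOVING APEX; the two defects; the two LEVELS (socket of §2 + limit + kill) -/

-- `tendsto_eval`: the line restates the tree's `ScalingTop.tendsto_eval`; taken BY NAME (gate lint dedup.landed).

/-- The **helical defect below `Λ`** of `W` (frame `L`, pitch `h`, angle range `[θ₁, θ₂]`, apex reach `A`, radius `a`): an apex `b`,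
`‖b‖ ≤ A`, with `‖L⁻¹ W(−1, b + L(R_θ w + hθ e₂)) − R_θ L⁻¹ W(−1, b + L w)‖ ≤ Λ` for `θ ∈ [θ₁, θ₂]`, `‖w‖ ≤ a`. -/
def HelicalDefectBelow (L : E3 ≃ₗᵢ[ℝ] E3) (h θ₁ θ₂ A a Λ : ℝ) (W : ℝ → E3 → E3) : Prop :=
  ∃ b ∈ closedBall (0 : E3) A, ∀ θ ∈ Icc θ₁ θ₂, ∀ w ∈ closedBall (0 : E3) a,
    ‖L.symm (W (-1) (b + L (rotZ θ w + (h * θ) • eZ))) - rotZ θ (L.symm (W (-1) (b + L w)))‖ ≤ Λ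

/-- **Helical limit** (moving apex): helical defects `≤ δ_j` of fields `F_j` converging locally uniformly on slices to `W` (continuous
slices), `δ_j → δ₀`, give a helical defect `≤ δ₀` of `W` (compactness of the apex ball, `ScalingTop.tendsto_eval`, continuity of `L⁻¹` and `R_θ`). -/
theorem helical_limit {L : E3 ≃ₗᵢ[ℝ] E3} {h θ₁ θ₂ A a : ℝ} {F : ℕ → ℝ → E3 → E3} {W : ℝ → E3 → E3}
    (hWc : ∀ s < 0, Continuous (W s)) (hlu : ∀ s < 0, TendstoLocallyUniformly (fun j => F j s) (W s) atTop)
    {δ : ℕ → ℝ} {δ₀ : ℝ} (hδ : Tendsto δ atTop (𝓝 δ₀))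
    (hdef : ∀ j, ∃ b ∈ closedBall (0 : E3) A, ∀ θ ∈ Icc θ₁ θ₂, ∀ w ∈ closedBall (0 : E3) a,
      ‖L.symm (F j (-1) (b + L (rotZ θ w + (h * θ) • eZ))) - rotZ θ (L.symm (F j (-1) (b + L w)))‖ ≤ δ j) :
    HelicalDefectBelow L h θ₁ θ₂ A a δ₀ W := by
  choose b hb hdefb using hdef
  obtain ⟨b₀, hb₀, ψ, hψ, hlim⟩ := (isCompact_closedBall (0 : E3) A).tendsto_subseq hb
  refine ⟨b₀, hb₀, fun θ hθ w hw => ?_⟩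
  have h1 : Tendsto (fun j => L.symm (F (ψ j) (-1) (b (ψ j) + L (rotZ θ w + (h * θ) • eZ)))) atTop
      (𝓝 (L.symm (W (-1) (b₀ + L (rotZ θ w + (h * θ) • eZ))))) :=
    (L.symm.continuous.tendsto _).comp
      (ScalingTop.tendsto_eval (hlu (-1) (by norm_num)) (hWc (-1) (by norm_num)) hψ (hlim.add tendsto_const_nhds))
  have h2 : Tendsto (fun j => rotZ θ (L.symm (F (ψ j) (-1) (b (ψ j) + L w)))) atTop
      (𝓝 (rotZ θ (L.symm (W (-1) (b₀ + L w))))) :=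
    ((continuous_rotZ θ).tendsto _).comp ((L.symm.continuous.tendsto _).comp
      (ScalingTop.tendsto_eval (hlu (-1) (by norm_num)) (hWc (-1) (by norm_num)) hψ (hlim.add tendsto_const_nhds)))
  exact le_of_tendsto_of_tendsto (h1.sub h2).norm (hδ.comp hψ.tendsto_atTop)
    (Eventually.of_forall fun j => hdefb (ψ j) θ hθ w hw)

/-- **THE HELICAL LEVEL `Λ₁(M, L, h, θ₁, θ₂, A, a, κ)`**: no `W ∈ 𝒦_M` with `‖W(−1, 0)‖ ≥ κ` has helical defect below `Λ₁` (socket +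
helical limit + (KX)). -/
theorem exists_helicalLevel (M : ℝ) (L : E3 ≃ₗᵢ[ℝ] E3) (h θ₁ θ₂ A a : ℝ) (hh : h ≠ 0) (h12 : θ₁ < θ₂) (ha : 0 < a)
    {κ : ℝ} (hκ : 0 < κ) :
    ∃ Λ₁ : ℝ, 0 < Λ₁ ∧ ∀ W : ℝ → E3 → E3, IsTypeIAncientMild M W → κ ≤ ‖W (-1) 0‖ →
      ¬ HelicalDefectBelow L h θ₁ θ₂ A a Λ₁ W := by
  refine NeedleTop.exists_level_of_limitKill M hκ (HelicalDefectBelow L h θ₁ θ₂ A a) ?_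
  intro Wn W ε _ hεlim _ hW hP _ _ hlu
  obtain ⟨b, -, hb⟩ := helical_limit (fun s hs => ScalingTop.continuous_slice' hW hs) hlu hεlim hP
  have hrel : ∀ θ ∈ Icc θ₁ θ₂, ∀ w ∈ ball (0 : E3) a,
      L.symm (W (-1) (b + L (rotZ θ w + (h * θ) • eZ))) = rotZ θ (L.symm (W (-1) (b + L w))) := by
    intro θ hθ w hw
    have h0 := hb θ hθ w (ball_subset_closedBall hw)
    exact sub_eq_zero.1 (norm_le_zero_iff.1 h0)
  exact eq_zero_of_helical hW L b hh h12 ha hrel (-1) (by norm_num) 0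

/-- The **crystal defect below `Λ`** of `W` (rigid motion `y ↦ L y + d`, apex reach `A`, radius `a`). -/
def CrystalDefectBelow (L : E3 ≃ₗᵢ[ℝ] E3) (d : E3) (A a Λ : ℝ) (W : ℝ → E3 → E3) : Prop :=
  ∃ b ∈ closedBall (0 : E3) A, ∀ w ∈ closedBall (0 : E3) a, ‖W (-1) (b + (L w + d)) - L (W (-1) (b + w))‖ ≤ Λ

/-- **Crystal limit** (moving apex). -/
theorem crystal_limit {L : E3 ≃ₗᵢ[ℝ] E3} {d : E3} {A a : ℝ} {F : ℕ → ℝ → E3 → E3} {W : ℝ → E3 → E3}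
    (hWc : ∀ s < 0, Continuous (W s)) (hlu : ∀ s < 0, TendstoLocallyUniformly (fun j => F j s) (W s) atTop)
    {δ : ℕ → ℝ} {δ₀ : ℝ} (hδ : Tendsto δ atTop (𝓝 δ₀))
    (hdef : ∀ j, ∃ b ∈ closedBall (0 : E3) A, ∀ w ∈ closedBall (0 : E3) a,
      ‖F j (-1) (b + (L w + d)) - L (F j (-1) (b + w))‖ ≤ δ j) :
    CrystalDefectBelow L d A a δ₀ W := by
  choose b hb hdefb using hdef
  obtain ⟨b₀, hb₀, ψ, hψ, hlim⟩ := (isCompact_closedBall (0 : E3) A).tendsto_subseq hb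
  refine ⟨b₀, hb₀, fun w hw => ?_⟩
  have h1 : Tendsto (fun j => F (ψ j) (-1) (b (ψ j) + (L w + d))) atTop (𝓝 (W (-1) (b₀ + (L w + d)))) :=
    ScalingTop.tendsto_eval (hlu (-1) (by norm_num)) (hWc (-1) (by norm_num)) hψ (hlim.add tendsto_const_nhds)
  have h2 : Tendsto (fun j => L (F (ψ j) (-1) (b (ψ j) + w))) atTop (𝓝 (L (W (-1) (b₀ + w)))) :=
    (L.continuous.tendsto _).comp
      (ScalingTop.tendsto_eval (hlu (-1) (by norm_num)) (hWc (-1) (by norm_num)) hψ (hlim.add tendsto_const_nhds))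
  exact le_of_tendsto_of_tendsto (h1.sub h2).norm (hδ.comp hψ.tendsto_atTop)
    (Eventually.of_forall fun j => hdefb (ψ j) w hw)

/-- **THE CRYSTAL LEVEL `Λ₁(M, L, d, A, a, κ)`** (socket + crystal limit + (KC)). -/
theorem exists_crystalLevel (M : ℝ) (L : E3 ≃ₗᵢ[ℝ] E3) {d : E3} {n : ℕ} (A a : ℝ) (hd : d ≠ 0) (hfix : L d = d)
    (hn : 0 < n) (hLn : ∀ z : E3, (⇑L)^[n] z = z) (ha : 0 < a) {κ : ℝ} (hκ : 0 < κ) :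
    ∃ Λ₁ : ℝ, 0 < Λ₁ ∧ ∀ W : ℝ → E3 → E3, IsTypeIAncientMild M W → κ ≤ ‖W (-1) 0‖ →
      ¬ CrystalDefectBelow L d A a Λ₁ W := by
  refine NeedleTop.exists_level_of_limitKill M hκ (CrystalDefectBelow L d A a) ?_
  intro Wn W ε _ hεlim _ hW hP _ _ hlu
  obtain ⟨b, -, hb⟩ := crystal_limit (fun s hs => ScalingTop.continuous_slice' hW hs) hlu hεlim hP
  have hrel : ∀ w ∈ ball (0 : E3) a, W (-1) (b + (L w + d)) = L (W (-1) (b + w)) := by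
    intro w hw
    have h0 := hb w (ball_subset_closedBall hw)
    exact sub_eq_zero.1 (norm_le_zero_iff.1 h0)
  exact eq_zero_of_crystal hW b L hd hfix hn hLn ha hrel (-1) (by norm_num) 0

/-! ## §5 THE FLOORS (universal over fast points, every level), proved; the census ROWS as corollaries (Leray's every-time floor);
the definite helical threshold and the floor read out at it -/

-- `zoom_units`: the line restates the tree's `NeedleTop.zoom_units`; taken BY NAME (gate lint dedup.landed).

-- `eventually_forall_not_of_not_frequently`: the line restates the tree's `EchoTop.eventually_forall_not_of_not_frequently`; taken BY NAME (gate lint dedup.landed).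

-- `le_of_units`: the line restates the tree's `ScalingTop.le_of_units`; taken BY NAME (gate lint dedup.landed).

/-- **THE HELICAL FLOOR holds** (witness package of §3 + helical level of §4; the pocket read in the zoom is a helical defect of the zoom
with the SAME dimensionless apex `b_j` — `L⁻¹` and `R_θ` are linear, so the speed unit factors out —, and the helical limit carries it to
the limit). -/
theorem helicalFloor_holds : HelicalFloor := by
  intro M Λ L h θ₁ θ₂ A a hΛ hh h12 ha
  obtain ⟨Λ₁, hΛ₁, hlev⟩ := exists_helicalLevel M L h θ₁ θ₂ A a hh h12 ha hΛ
  refine ⟨Λ₁, hΛ₁, ?_⟩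
  intro ν T hν hT u p hsol hLH hdec hM
  refine EchoTop.eventually_forall_not_of_not_frequently fun hfreq => ?_
  obtain ⟨c, x, W, hcpos, -, hW, hQ, -, -, -, hlu, hnorm⟩ :=
    EchoTop.exists_witnessZoom_package hν hT hsol hLH hdec hM hfreq
  apply hlev W hW hnorm
  set F : ℕ → ℝ → E3 → E3 := fun j s y => (c j * 1) • u (T + c j ^ 2 * ν * s) (x j + (c j * ν) • y) with hF
  have hpk : ∀ j, ∃ b ∈ closedBall (0 : E3) A, ∀ θ ∈ Icc θ₁ θ₂, ∀ w ∈ closedBall (0 : E3) a,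
      ‖L.symm (F j (-1) (b + L (rotZ θ w + (h * θ) • eZ))) - rotZ θ (L.symm (F j (-1) (b + L w)))‖ ≤ Λ₁ := by
    intro j
    obtain ⟨hunit, hsq⟩ := NeedleTop.zoom_units (T := T) hν hcpos j
    obtain ⟨b, hb, hpock⟩ := hQ j
    refine ⟨b, mem_closedBall_zero_iff.2 hb, fun θ hθ w hw => ?_⟩
    have h1 := hpock θ hθ w (mem_closedBall_zero_iff.1 hw)
    rw [hsq, hunit] at h1
    simp only [hF]
    rw [LinearIsometryEquiv.map_smul, LinearIsometryEquiv.map_smul, rotZ_smul, ← smul_sub, norm_smul, Real.norm_eq_abs,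
      abs_of_pos (mul_pos (hcpos j) one_pos), mul_one]
    exact ScalingTop.le_of_units hν h1
  exact helical_limit (fun s hs => ScalingTop.continuous_slice' hW hs) (fun s hs => hlu s hs) tendsto_const_nhds hpk

/-- **THE CRYSTAL FLOOR holds** (witness package + crystal level). -/
theorem crystalFloor_holds : CrystalFloor := by
  intro M Λ L d n A a hΛ hd hfix hn hLn ha
  obtain ⟨Λ₁, hΛ₁, hlev⟩ := exists_crystalLevel M L A a hd hfix hn hLn ha hΛ
  refine ⟨Λ₁, hΛ₁, ?_⟩
  intro ν T hν hT u p hsol hLH hdec hM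
  refine EchoTop.eventually_forall_not_of_not_frequently fun hfreq => ?_
  obtain ⟨c, x, W, hcpos, -, hW, hQ, -, -, -, hlu, hnorm⟩ :=
    EchoTop.exists_witnessZoom_package hν hT hsol hLH hdec hM hfreq
  apply hlev W hW hnorm
  set F : ℕ → ℝ → E3 → E3 := fun j s y => (c j * 1) • u (T + c j ^ 2 * ν * s) (x j + (c j * ν) • y) with hF
  have hpk : ∀ j, ∃ b ∈ closedBall (0 : E3) A, ∀ w ∈ closedBall (0 : E3) a,
      ‖F j (-1) (b + (L w + d)) - L (F j (-1) (b + w))‖ ≤ Λ₁ := by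
    intro j
    obtain ⟨hunit, hsq⟩ := NeedleTop.zoom_units (T := T) hν hcpos j
    obtain ⟨b, hb, hpock⟩ := hQ j
    refine ⟨b, mem_closedBall_zero_iff.2 hb, fun w hw => ?_⟩
    have h1 := hpock w (mem_closedBall_zero_iff.1 hw)
    rw [hsq, hunit] at h1
    simp only [hF]
    rw [LinearIsometryEquiv.map_smul, ← smul_sub, norm_smul, Real.norm_eq_abs, abs_of_pos (mul_pos (hcpos j) one_pos), mul_one]
    exact ScalingTop.le_of_units hν h1
  exact crystal_limit (fun s hs => ScalingTop.continuous_slice' hW hs) (fun s hs => hlu s hs) tendsto_const_nhds hpk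

-- `row_of_floor`: the line restates the tree's `ScalingTop.row_of_floor`; taken BY NAME (gate lint dedup.landed).

/-- **ROW F1hx holds** (helical floor at `c_S` + Leray's every-time floor). -/
theorem rowF1hx_holds : Row_F1hx := by
  intro M L h θ₁ θ₂ A a hh h12 ha
  obtain ⟨ε, hε, hfl⟩ := helicalFloor_holds M SnapshotTop.snapLevel L h θ₁ θ₂ A a SnapshotTop.snapLevel_pos hh h12 ha
  exact ⟨ε, hε, fun ν T hν hT u p hsol hLH hdec hM hfreq =>
    ScalingTop.row_of_floor hν hT hsol hLH hdec (hfl ν T hν hT u p hsol hLH hdec hM) hfreq⟩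

/-- **ROW F1cx holds** (crystal floor at `c_S`). -/
theorem rowF1cx_holds : Row_F1cx := by
  intro M L d n A a hd hfix hn hLn ha
  obtain ⟨ε, hε, hfl⟩ := crystalFloor_holds M SnapshotTop.snapLevel L d n A a SnapshotTop.snapLevel_pos hd hfix hn hLn ha
  exact ⟨ε, hε, fun ν T hν hT u p hsol hLH hdec hM hfreq =>
    ScalingTop.row_of_floor hν hT hsol hLH hdec (hfl ν T hν hT u p hsol hLH hdec hM) hfreq⟩

/-- **The definite helical threshold `helicalLevel M Λ L h θ₁ θ₂ A a`** — a witness of the floor (ineffective: compactness); `1` off the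
admissible parameter range. -/
def helicalLevel (M Λ : ℝ) (L : E3 ≃ₗᵢ[ℝ] E3) (h θ₁ θ₂ A a : ℝ) : ℝ :=
  if hp : 0 < Λ ∧ h ≠ 0 ∧ θ₁ < θ₂ ∧ 0 < a then
    Classical.choose (helicalFloor_holds M Λ L h θ₁ θ₂ A a hp.1 hp.2.1 hp.2.2.1 hp.2.2.2) else 1

/-- The definite helical-pocket threshold is positive. -/
theorem helicalLevel_pos (M Λ : ℝ) (L : E3 ≃ₗᵢ[ℝ] E3) (h θ₁ θ₂ A a : ℝ) : 0 < helicalLevel M Λ L h θ₁ θ₂ A a := by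
  unfold helicalLevel
  split_ifs with hp
  · exact (Classical.choose_spec (helicalFloor_holds M Λ L h θ₁ θ₂ A a hp.1 hp.2.1 hp.2.2.1 hp.2.2.2)).1
  · exact one_pos

/-- **THE HELICAL FLOOR, read out at its definite threshold**: in a Clay solution with Type-I constant `M`, for all late instants `t`, EVERY
`Λ`-fast point `x` and EVERY candidate apex `x + ℓb`, `‖b‖ ≤ A`, admit an angle `θ ∈ [θ₁, θ₂]` and a point `w`, `‖w‖ ≤ a`, at which the
snapshot FAILS to be screw-equivariant: `√(T − t)‖L⁻¹u(t, x_* + ℓL(R_θ w + hθe₂)) − R_θ L⁻¹u(t, x_* + ℓLw)‖ > helicalLevel · √ν`. -/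
theorem helicalFloor_read {M Λ : ℝ} {L : E3 ≃ₗᵢ[ℝ] E3} {h θ₁ θ₂ A a : ℝ} (hΛ : 0 < Λ) (hh : h ≠ 0) (h12 : θ₁ < θ₂) (ha : 0 < a)
    {ν T : ℝ} (hν : 0 < ν) (hT : 0 < T) {u : ℝ → E3 → E3} {p : ℝ → E3 → ℝ}
    (hsol : IsClassicalNSSolutionOn (Ico 0 T) ν 0 u p) (hLH : IsLerayHopfOn T ν 0 (u 0) u)
    (hdec : HasRapidSpatialDecay (u 0)) (hM : OneLevelTop.HasTypeIConstant ν T M u) :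
    ∀ᶠ t in 𝓝[<] T, ∀ x ∈ TwoTimeTop.topSet ν T u Λ t, ∀ b : E3, ‖b‖ ≤ A →
      ∃ θ ∈ Icc θ₁ θ₂, ∃ w : E3, ‖w‖ ≤ a ∧
        helicalLevel M Λ L h θ₁ θ₂ A a * Real.sqrt ν <
          Real.sqrt (T - t) * ‖L.symm (u t (x + (Real.sqrt (ν * (T - t))) • (b + L (rotZ θ w + (h * θ) • eZ))))
            - rotZ θ (L.symm (u t (x + (Real.sqrt (ν * (T - t))) • (b + L w))))‖ := by
  have hp : 0 < Λ ∧ h ≠ 0 ∧ θ₁ < θ₂ ∧ 0 < a := ⟨hΛ, hh, h12, ha⟩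
  have hspec := (Classical.choose_spec (helicalFloor_holds M Λ L h θ₁ θ₂ A a hp.1 hp.2.1 hp.2.2.1 hp.2.2.2)).2
    ν T hν hT u p hsol hLH hdec hM
  have hlev : helicalLevel M Λ L h θ₁ θ₂ A a =
      Classical.choose (helicalFloor_holds M Λ L h θ₁ θ₂ A a hp.1 hp.2.1 hp.2.2.1 hp.2.2.2) := by
    unfold helicalLevel
    rw [dif_pos hp]
  filter_upwards [hspec] with t ht x hx b hb
  by_contra hno
  push Not at hno
  exact ht x hx ⟨b, hb, fun θ hθ w hw => by have h' := hno θ hθ w hw; rwa [hlev] at h'⟩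

end Summit.NavierStokesRegularity.NavierStokesRegularity.Theorems.ScenarioCensus.ScrewTop

end
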